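/-
Copyright (c) 2026 the pub-hodgecm-mathlib formalisation cell (harness21).  Prover seat hodgecm-mathlib-K2E3-p11 (g6), Track B «K2-LIT» ∕ h413
(`stmt-HodgeConjecture-24833`), line `K2_E3_EllipticInputs`, road (11-3-split-nsc) `sig_K2E3CharLocIntNearSemisimpleSplitThreeNonSupercuspidal` (U12 ED. 20 :419),
brick (nsc-K𝔭-AC-T), part 1∕2: THE TRANSPORT PRINCIPLE FOR THE `K M U` ABSOLUTE CONTINUITY and the involution `g ↦ w₀ (gᵀ)⁻¹ w₀` of `GL₃(F)`.  2026-09-04.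
-/
import Summits.HodgeConjecture.HodgeConjecture.Theorems.K2E3GL3ParabolicKMUAbsCont      -- ★ p858599 (this seat): the `GL₃(F)` measure-theoretic frame ((AC) for `![false,false,true]` is consumed in part 2)
import Literature.NumberTheory.Automorphic.GLnTwoBlockLeviStructure                   -- ★ `mem_standardLeviGL_iff`
import Literature.NumberTheory.Automorphic.ReductiveGroupData                         -- ★ `glInt`, `mem_glInt_iff`
import Literature.NumberTheory.Automorphic.ParabolicInductionRefinementProofs          -- ★ `apply_eq_of_mem_unipotentRadicalGL`
import HarnessLib

/-!
# K2_E3 road (h413), (11-3-split-nsc) brick (nsc-K𝔭-AC-T), part 1∕2 — the TRANSPORT PRINCIPLE for the `K M U` absolute continuity along continuous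
# automorphisms of `GL₃(F)`, and the involution `θ(g) = w₀ · (gᵀ)⁻¹ · w₀` exchanging the two maximal standard parabolics

Cell `pub/hodgecm-mathlib` (D-0151), Track B, seat K2E3-p11 (g6) = road owner of (11-3-split-nsc) (BRICK LIST v2; bus 2026-09-04 ≈08:35Z «TAKING (AC-P₁₂) BY
TRANSPORT»).  `--supports stmt-HodgeConjecture-24833 --as helper`; THEOREMS ONLY (no definition ∕ instance ∕ notation ∕ named fact ∕ `sorry`; the involution `θ` is
delivered by an EXISTENCE theorem); never imports `Cruxes/…/Lines`.  COUNT-NEUTRAL.  Consumer: the (nsc-S-C′) interior road of K2E3-p24 (g0) («(AC-c) for BOTH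
two-block labels», bus 08:28:59Z) and any `Fin 2`-labelled use of ★ (nsc-vD-gen).

THE MATHEMATICS ([HarishChandra1970, Part V §4 Lemma 22]; [vanDijk1972, Thm. p. 237]; [BernsteinZelevinsky1977, §2.1]).  (§1) If `θ : G ≃ₜ* G` (`G = GL₃(F)`) maps
`K = GL₃(𝒪)` onto itself, `M₁` onto `M₂` and `U₁` onto `U₂`, then (AC) for `(K, M₂, U₂)` implies (AC) for `(K, M₁, U₁)`: push the three Haar measures forward
along the restricted isomorphisms (Haar again), note `θ(k⁻¹ m u k) = θk⁻¹ θm θu θk` and that `θ(A)` is `μ₀`-null (`μ₀ ∘ θ⁻¹` is a Haar measure, `= c·μ₀` by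
uniqueness).  With `θ = id` this also moves (AC) between two LABELLINGS of the same pair of subgroups.  (§2) The involution `θ(g) = w₀ (gᵀ)⁻¹ w₀`
(`w₀` = the antidiagonal permutation; entries `θ(g)ᵢⱼ = (g⁻¹)_{2−j, 2−i}`) is a continuous group automorphism of `GL₃(F)` mapping `GL₃(𝒪)` to itself,
`M₍₁,₂₎ = diag(GL₁ × GL₂)` onto `M₍₂,₁₎ = diag(GL₂ × GL₁)` and `U₍₁,₂₎` onto `U₍₂,₁₎` (membership is read on `g⁻¹`, so no inverse is ever computed: transpose +
index reversal of the defining zero∕one pattern).  (§3) Hence (AC) for the label `![false, true, true]` from ★ (AC-P₂₁) for `![false, false, true]`, and, by the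
`θ = id` case of §1, for the two monotone surjective labels `c : Fin 3 → Fin 2` (`c = ![0,0,1]` or `![0,1,1]`).

* §0 matrix entries of `w₀ X w₀`; entrywise membership in `U_c`; the monotone surjective `Fin 3 → Fin 2` labels.
* §1 **`kmuNull_of_continuousMulEquiv`** — the transport principle.
* §2 **`exists_continuousMulEquiv_transposeInv_rev`** (the involution `θ` with its entry formula) and the three membership transfers.
* §3 (part 2∕2, `K2E3GL3ParabolicKMUAbsContOneTwo`): `parabolicKMU_null_of_haar_null_oneTwo` (label `![false,true,true]`), `parabolicKMU_null_of_haar_null_fin2`.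

HONEST LABEL: HC_CM is proved only modulo the 7 printed citations (2 remaining named inputs: hLiu418 = stmt-HodgeConjecture-24832, h413 =
stmt-HodgeConjecture-24833) until rung 0 closes; count-neutral helper.

## References
* [HarishChandra1970] Harish-Chandra (notes by G. van Dijk), *Harmonic Analysis on Reductive p-adic Groups*, LNM 162 (1970), Part V §4 Lemma 22.
* [vanDijk1972] G. van Dijk, *Computation of certain induced characters of 𝔭-adic groups*, Math. Ann. 199 (1972), Thm. p. 237.
* [BernsteinZelevinsky1977] I. N. Bernstein, A. V. Zelevinsky, *Induced representations of reductive 𝔭-adic groups I*, §2.1 (standard parabolics `P_β = M_β U_β`).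
-/

set_option autoImplicit false
set_option linter.dupNamespace false

noncomputable section

open MeasureTheory MeasureTheory.Measure Set Function Topology Filter Matrix
open scoped NNReal ENNReal MatrixGroups Pointwise
open Literature.NumberTheory.GaloisRepresentations Literature.NumberTheory.GaloisRepresentations.IsNonarchimedeanLocalField
open Literature.NumberTheory.Automorphic

namespace Summit.HodgeConjecture.HodgeConjecture.Cruxes.H413.K2E3GL3KMUAbsContTransport

/-! ## §0  Matrix bookkeeping -/

section Matrices

variable {R : Type*} [CommRing R]

/-- Entries of `w₀ X w₀` for the antidiagonal `w₀ = !![0,0,1; 0,1,0; 1,0,0]`: `(w₀ X w₀)ᵢⱼ = X_{rev i, rev j}`. [cite: BernsteinZelevinsky1977, §2.1] -/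
theorem antidiag_mul_mul_antidiag_apply (X : Matrix (Fin 3) (Fin 3) R) (i j : Fin 3) :
    (((!![0, 0, 1; 0, 1, 0; 1, 0, 0] : Matrix (Fin 3) (Fin 3) R) * X * (!![0, 0, 1; 0, 1, 0; 1, 0, 0] : Matrix (Fin 3) (Fin 3) R) :
      Matrix (Fin 3) (Fin 3) R) i j) = X i.rev j.rev := by
  fin_cases i <;> fin_cases j <;> simp [Matrix.mul_apply, Fin.sum_univ_three, Matrix.vecMul, dotProduct]

/-- `w₀ w₀ = 1`. [cite: BernsteinZelevinsky1977, §2.1] -/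
theorem antidiag_mul_antidiag :
    ((!![0, 0, 1; 0, 1, 0; 1, 0, 0] : Matrix (Fin 3) (Fin 3) R) * (!![0, 0, 1; 0, 1, 0; 1, 0, 0] : Matrix (Fin 3) (Fin 3) R)) = 1 := by
  ext i j
  fin_cases i <;> fin_cases j <;> simp

/-- **Entrywise membership in the unipotent radical `U_c`** (`3 × 3`, any linearly ordered label type): `g ∈ U_c` iff `gᵢⱼ = 0` below the blocks
(`c j < c i`) and `gᵢⱼ = δᵢⱼ` inside the diagonal blocks (`c i = c j`) — ★ `mem_unipotentRadicalGL_iff` unfolded. [cite: BernsteinZelevinsky1977, §2.1] -/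
theorem mem_unipotentRadicalGL_iff_entry {α : Type*} [LinearOrder α] (c : Fin 3 → α) (g : GL (Fin 3) R) :
    g ∈ unipotentRadicalGL R c ↔ (∀ i j, c j < c i → (g : Matrix (Fin 3) (Fin 3) R) i j = 0) ∧
      (∀ i j, c i = c j → (g : Matrix (Fin 3) (Fin 3) R) i j = if i = j then 1 else 0) := by
  classical
  constructor
  · intro hg
    refine ⟨fun i j hij => ((mem_unipotentRadicalGL_iff c g).1 hg).1 hij, fun i j hij => apply_eq_of_mem_unipotentRadicalGL c hg i j hij⟩
  · rintro ⟨h0, h1⟩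
    refine (mem_unipotentRadicalGL_iff c g).2 ⟨fun i j hij => h0 i j hij, fun a => ?_⟩
    ext ⟨i, hi⟩ ⟨j, hj⟩
    rw [Matrix.toSquareBlock_def, Matrix.of_apply, h1 i j (hi.trans hj.symm), Matrix.one_apply]
    by_cases hij : i = j
    · subst hij; simp
    · rw [if_neg hij, if_neg (fun e => hij (congrArg Subtype.val e))]

/-- The monotone surjective labellings `Fin 3 → Fin 2` are `(0,0,1)` and `(0,1,1)`. [folklore] -/
theorem eq_of_monotone_surjective_fin2 (c : Fin 3 → Fin 2) (hc : Monotone c) (hcs : Function.Surjective c) :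
    c = ![0, 0, 1] ∨ c = ![0, 1, 1] := by
  have h0 : c 0 = 0 := by
    obtain ⟨i, hi⟩ := hcs 0
    have := hc (Fin.zero_le i)
    rw [hi] at this
    exact le_antisymm this (Fin.zero_le _)
  have h2 : c 2 = 1 := by
    obtain ⟨i, hi⟩ := hcs 1
    have := hc (Fin.le_last i)
    rw [hi] at this
    exact le_antisymm (Fin.le_last _) this
  rcases Fin.exists_fin_two.1 ⟨c 1, rfl⟩ with h1 | h1
  · left; funext i; fin_cases i <;> simp [h0, h1, h2]
  · right; funext i; fin_cases i <;> simp [h0, h1, h2]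

end Matrices

/-! ## §1  The transport principle -/

section Transport

variable {F : Type*} [Field F] [ValuativeRel F] [TopologicalSpace F] [IsNonarchimedeanLocalField F]
  [MeasurableSpace (GL (Fin 3) F)] [BorelSpace (GL (Fin 3) F)]

omit [ValuativeRel F] [IsNonarchimedeanLocalField F] [MeasurableSpace (GL (Fin 3) F)] [BorelSpace (GL (Fin 3) F)] in
/-- A continuous group isomorphism `θ` with `g ∈ H₁ ↔ θ g ∈ H₂` restricts to `↥H₁ ≃ₜ* ↥H₂` over `θ`. [folklore] -/
theorem exists_restrict_continuousMulEquiv (θ : GL (Fin 3) F ≃ₜ* GL (Fin 3) F) {H₁ H₂ : Subgroup (GL (Fin 3) F)}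
    (h : ∀ g, g ∈ H₁ ↔ θ g ∈ H₂) :
    ∃ e : ↥H₁ ≃ₜ* ↥H₂, ∀ x : ↥H₁, ((e x : ↥H₂) : GL (Fin 3) F) = θ (x : GL (Fin 3) F) := by
  refine ⟨{ toFun := fun x => ⟨θ x, (h x).1 x.2⟩
            invFun := fun y => ⟨θ.symm y, (h (θ.symm y)).2 (by rw [ContinuousMulEquiv.apply_symm_apply]; exact y.2)⟩
            left_inv := fun x => Subtype.ext (θ.symm_apply_apply x)
            right_inv := fun y => Subtype.ext (θ.apply_symm_apply y)
            map_mul' := fun a b => Subtype.ext (by simp only [Subgroup.coe_mul, map_mul])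
            continuous_toFun := (θ.continuous.comp continuous_subtype_val).subtype_mk _
            continuous_invFun := (θ.symm.continuous.comp continuous_subtype_val).subtype_mk _ }, fun x => rfl⟩

/-- **THE TRANSPORT PRINCIPLE FOR (AC).**  Let `θ : GL₃(F) ≃ₜ* GL₃(F)` satisfy `g ∈ K ↔ θ g ∈ K`, `g ∈ M₁ ↔ θ g ∈ M₂`, `g ∈ U₁ ↔ θ g ∈ U₂` for closed subgroups
`K, M₁, U₁` (and subgroups `M₂, U₂`), and let `μ₀` be a Haar measure.  If for ALL Haar measures on `M₂, U₂, K` the push-forward `(k, m, u) ↦ k⁻¹ (m u) k` charges no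
`μ₀`-null set, then the same holds for `M₁, U₁, K`: push the Haar triple along the restricted isomorphisms (Haar again), use `θ(k⁻¹ m u k) = θk⁻¹ θm θu θk` and
`μ₀(θ A) = 0` (`μ₀ ∘ θ⁻¹` is a Haar measure, `= c·μ₀` by uniqueness). [cite: HarishChandra1970, Part V §4 Lemma 22] [cite: BernsteinZelevinsky1977, §2.1] -/
theorem kmuNull_of_continuousMulEquiv (θ : GL (Fin 3) F ≃ₜ* GL (Fin 3) F)
    {K M₁ U₁ M₂ U₂ : Subgroup (GL (Fin 3) F)} (hKc : IsClosed (K : Set (GL (Fin 3) F)))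
    (hM₁c : IsClosed (M₁ : Set (GL (Fin 3) F))) (hU₁c : IsClosed (U₁ : Set (GL (Fin 3) F)))
    (hK : ∀ g, g ∈ K ↔ θ g ∈ K) (hM : ∀ g, g ∈ M₁ ↔ θ g ∈ M₂) (hU : ∀ g, g ∈ U₁ ↔ θ g ∈ U₂)
    (μ₀ : Measure (GL (Fin 3) F)) [μ₀.IsHaarMeasure]
    (h₂ : ∀ (νM : Measure ↥M₂) [νM.IsHaarMeasure] (μU : Measure ↥U₂) [μU.IsHaarMeasure] (μK : Measure ↥K) [μK.IsHaarMeasure]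
      (A : Set (GL (Fin 3) F)), MeasurableSet A → μ₀ A = 0 →
      (μK.prod (νM.prod μU)) {t : ↥K × (↥M₂ × ↥U₂) |
        ((t.1 : GL (Fin 3) F))⁻¹ * ((t.2.1 : GL (Fin 3) F) * (t.2.2 : GL (Fin 3) F)) * (t.1 : GL (Fin 3) F) ∈ A} = 0)
    (νM : Measure ↥M₁) [νM.IsHaarMeasure] (μU : Measure ↥U₁) [μU.IsHaarMeasure] (μK : Measure ↥K) [μK.IsHaarMeasure]
    (A : Set (GL (Fin 3) F)) (hA : MeasurableSet A) (hA0 : μ₀ A = 0) :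
    (μK.prod (νM.prod μU)) {t : ↥K × (↥M₁ × ↥U₁) |
      ((t.1 : GL (Fin 3) F))⁻¹ * ((t.2.1 : GL (Fin 3) F) * (t.2.2 : GL (Fin 3) F)) * (t.1 : GL (Fin 3) F) ∈ A} = 0 := by
  classical
  -- §0 frame
  haveI : T2Space F := (isLocalField F).toT2Space
  haveI : LocallyCompactSpace F := (isLocalField F).toLocallyCompactSpace
  haveI : SecondCountableTopology F := secondCountableTopology_localField F
  haveI : IsTopologicalRing F := inferInstance
  haveI : SecondCountableTopology (Matrix (Fin 3) (Fin 3) F) := inferInstanceAs (SecondCountableTopology (Fin 3 → Fin 3 → F))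
  haveI : LocallyCompactSpace (Matrix (Fin 3) (Fin 3) F) := Pi.locallyCompactSpace_of_finite
  haveI : SecondCountableTopology (Matrix (Fin 3) (Fin 3) F)ᵐᵒᵖ := MulOpposite.opHomeomorph.symm.secondCountableTopology
  haveI : SecondCountableTopology (GL (Fin 3) F) := Units.isEmbedding_embedProduct.secondCountableTopology
  haveI : LocallyCompactSpace (GL (Fin 3) F) := inferInstance
  haveI : SigmaCompactSpace (GL (Fin 3) F) := sigmaCompactSpace_of_locallyCompact_secondCountable
  haveI : SecondCountableTopology ↥K := TopologicalSpace.Subtype.secondCountableTopology _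
  haveI : SecondCountableTopology ↥M₁ := TopologicalSpace.Subtype.secondCountableTopology _
  haveI : SecondCountableTopology ↥U₁ := TopologicalSpace.Subtype.secondCountableTopology _
  haveI : SecondCountableTopology ↥M₂ := TopologicalSpace.Subtype.secondCountableTopology _
  haveI : SecondCountableTopology ↥U₂ := TopologicalSpace.Subtype.secondCountableTopology _
  haveI : BorelSpace ↥K := Subtype.borelSpace _
  haveI : BorelSpace ↥M₁ := Subtype.borelSpace _
  haveI : BorelSpace ↥U₁ := Subtype.borelSpace _
  haveI : BorelSpace ↥M₂ := Subtype.borelSpace _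
  haveI : BorelSpace ↥U₂ := Subtype.borelSpace _
  haveI : SigmaCompactSpace ↥K := hKc.isClosedEmbedding_subtypeVal.sigmaCompactSpace
  haveI : SigmaCompactSpace ↥M₁ := hM₁c.isClosedEmbedding_subtypeVal.sigmaCompactSpace
  haveI : SigmaCompactSpace ↥U₁ := hU₁c.isClosedEmbedding_subtypeVal.sigmaCompactSpace
  haveI : BorelSpace (↥M₁ × ↥U₁) := Prod.borelSpace
  haveI : BorelSpace (↥K × (↥M₁ × ↥U₁)) := Prod.borelSpace
  haveI : BorelSpace (↥M₂ × ↥U₂) := Prod.borelSpace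
  haveI : BorelSpace (↥K × (↥M₂ × ↥U₂)) := Prod.borelSpace
  haveI : SigmaFinite νM := inferInstance
  haveI : SigmaFinite μU := inferInstance
  haveI : SigmaFinite μK := inferInstance
  -- the restricted isomorphisms and the transported Haar triple
  obtain ⟨θK, hθK⟩ := exists_restrict_continuousMulEquiv θ hK
  obtain ⟨θM, hθM⟩ := exists_restrict_continuousMulEquiv θ hM
  obtain ⟨θU, hθU⟩ := exists_restrict_continuousMulEquiv θ hU
  set νM' : Measure ↥M₂ := νM.map θM with hνM'
  set μU' : Measure ↥U₂ := μU.map θU with hμU'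
  set μK' : Measure ↥K := μK.map θK with hμK'
  haveI : νM'.IsHaarMeasure := θM.isHaarMeasure_map νM
  haveI : μU'.IsHaarMeasure := θU.isHaarMeasure_map μU
  haveI : μK'.IsHaarMeasure := θK.isHaarMeasure_map μK
  -- the image `θ A` is measurable and `μ₀`-null
  have hmθ : Measurable θ := θ.continuous.measurable
  have hmθs : Measurable θ.symm := θ.symm.continuous.measurable
  have himage : θ '' A = θ.symm ⁻¹' A := by
    ext x
    constructor
    · rintro ⟨a, ha, rfl⟩
      simpa [Set.mem_preimage] using ha
    · intro hx
      exact ⟨θ.symm x, hx, θ.apply_symm_apply x⟩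
  have hA' : MeasurableSet (θ '' A) := by rw [himage]; exact hA.preimage hmθs
  have hA'0 : μ₀ (θ '' A) = 0 := by
    haveI : (μ₀.map θ.symm).IsHaarMeasure := θ.symm.isHaarMeasure_map μ₀
    have hsmul := isMulLeftInvariant_eq_smul (μ₀.map θ.symm) μ₀
    have h1 : (μ₀.map θ.symm) A = 0 := by
      rw [hsmul, Measure.smul_apply, hA0, smul_zero]
    rw [himage, ← Measure.map_apply hmθs hA, h1]
  -- the (AC) statement on the `(M₂, U₂)` side, for the transported triple and `θ A`
  have h := h₂ νM' μU' μK' (θ '' A) hA' hA'0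
  -- the joint map and the two sets
  have hmK : Measurable (θK : ↥K → ↥K) := θK.continuous.measurable
  have hmM : Measurable (θM : ↥M₁ → ↥M₂) := θM.continuous.measurable
  have hmU : Measurable (θU : ↥U₁ → ↥U₂) := θU.continuous.measurable
  set Θ : ↥K × (↥M₁ × ↥U₁) → ↥K × (↥M₂ × ↥U₂) := Prod.map θK (Prod.map θM θU) with hΘ
  have hΘm : Measurable Θ := hmK.prodMap (hmM.prodMap hmU)
  have hS₂m : MeasurableSet {t : ↥K × (↥M₂ × ↥U₂) |
      ((t.1 : GL (Fin 3) F))⁻¹ * ((t.2.1 : GL (Fin 3) F) * (t.2.2 : GL (Fin 3) F)) * (t.1 : GL (Fin 3) F) ∈ θ '' A} := by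
    refine hA'.preimage (Continuous.measurable ?_)
    exact ((continuous_subtype_val.comp continuous_fst).inv.mul
      ((continuous_subtype_val.comp (continuous_fst.comp continuous_snd)).mul (continuous_subtype_val.comp (continuous_snd.comp continuous_snd)))).mul
      (continuous_subtype_val.comp continuous_fst)
  have hprod : μK'.prod (νM'.prod μU') = (μK.prod (νM.prod μU)).map Θ := by
    rw [hμK', hνM', hμU', Measure.map_prod_map _ _ hmM hmU, Measure.map_prod_map _ _ hmK (hmM.prodMap hmU)]
  rw [hprod, Measure.map_apply hΘm hS₂m] at h
  have hset : Θ ⁻¹' {t : ↥K × (↥M₂ × ↥U₂) |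
      ((t.1 : GL (Fin 3) F))⁻¹ * ((t.2.1 : GL (Fin 3) F) * (t.2.2 : GL (Fin 3) F)) * (t.1 : GL (Fin 3) F) ∈ θ '' A} =
      {t : ↥K × (↥M₁ × ↥U₁) | ((t.1 : GL (Fin 3) F))⁻¹ * ((t.2.1 : GL (Fin 3) F) * (t.2.2 : GL (Fin 3) F)) * (t.1 : GL (Fin 3) F) ∈ A} := by
    ext t
    simp only [hΘ, Set.mem_preimage, Set.mem_setOf_eq, Prod.map_fst, Prod.map_snd, hθK, hθM, hθU, ← map_mul, ← map_inv]
    exact θ.injective.mem_set_image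
  rw [hset] at h
  exact h

end Transport

/-! ## §2  The involution `θ(g) = w₀ (gᵀ)⁻¹ w₀` of `GL₃(F)` -/

section Theta

variable {F : Type*} [Field F] [TopologicalSpace F] [IsTopologicalRing F]

/-- **The involution `θ(g) = w₀ · (gᵀ)⁻¹ · w₀`** is a continuous group automorphism of `GL₃(F)` with entries `θ(g)ᵢⱼ = (g⁻¹)_{rev j, rev i}` and `θ ∘ θ = id`
(`w₀` the antidiagonal permutation matrix; delivered as an existence statement — no definition). [cite: BernsteinZelevinsky1977, §2.1] -/
theorem exists_continuousMulEquiv_transposeInv_rev :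
    ∃ θ : GL (Fin 3) F ≃ₜ* GL (Fin 3) F,
      (∀ (g : GL (Fin 3) F) (i j : Fin 3), ((θ g : GL (Fin 3) F) : Matrix (Fin 3) (Fin 3) F) i j =
        ((g⁻¹ : GL (Fin 3) F) : Matrix (Fin 3) (Fin 3) F) j.rev i.rev) ∧
      ∀ g : GL (Fin 3) F, θ (θ g) = g := by
  -- the antidiagonal as a unit
  have hWW : ((!![0, 0, 1; 0, 1, 0; 1, 0, 0] : Matrix (Fin 3) (Fin 3) F) * (!![0, 0, 1; 0, 1, 0; 1, 0, 0] : Matrix (Fin 3) (Fin 3) F)) = 1 :=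
    antidiag_mul_antidiag
  let Wu : GL (Fin 3) F := ⟨!![0, 0, 1; 0, 1, 0; 1, 0, 0], !![0, 0, 1; 0, 1, 0; 1, 0, 0], hWW, hWW⟩
  have hWu2 : Wu * Wu = 1 := Units.ext hWW
  -- transpose-inverse on units
  let t : GL (Fin 3) F → GL (Fin 3) F := fun g =>
    ⟨((g⁻¹ : GL (Fin 3) F) : Matrix (Fin 3) (Fin 3) F)ᵀ, ((g : GL (Fin 3) F) : Matrix (Fin 3) (Fin 3) F)ᵀ,
      by rw [← Matrix.transpose_mul, Units.mul_inv, Matrix.transpose_one],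
      by rw [← Matrix.transpose_mul, Units.inv_mul, Matrix.transpose_one]⟩
  have ht_val : ∀ g, ((t g : GL (Fin 3) F) : Matrix (Fin 3) (Fin 3) F) = ((g⁻¹ : GL (Fin 3) F) : Matrix (Fin 3) (Fin 3) F)ᵀ := fun g => rfl
  have ht_inv_val : ∀ g, (((t g)⁻¹ : GL (Fin 3) F) : Matrix (Fin 3) (Fin 3) F) = ((g : GL (Fin 3) F) : Matrix (Fin 3) (Fin 3) F)ᵀ := fun g => rfl
  have ht_mul : ∀ g h, t (g * h) = t g * t h := fun g h => Units.ext (by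
    rw [Units.val_mul, ht_val, ht_val, ht_val, _root_.mul_inv_rev, Units.val_mul, Matrix.transpose_mul])
  have ht_invol : ∀ g, t (t g) = g := fun g => Units.ext (by rw [ht_val, ht_inv_val, Matrix.transpose_transpose])
  have ht_W : t Wu = Wu := Units.ext (by
    rw [ht_val]
    change ((!![0, 0, 1; 0, 1, 0; 1, 0, 0] : Matrix (Fin 3) (Fin 3) F))ᵀ = !![0, 0, 1; 0, 1, 0; 1, 0, 0]
    ext i j; fin_cases i <;> fin_cases j <;> rfl)
  have ht_cont : Continuous t := by
    refine Units.continuous_iff.2 ⟨?_, ?_⟩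
    · show Continuous fun g : GL (Fin 3) F => ((g⁻¹ : GL (Fin 3) F) : Matrix (Fin 3) (Fin 3) F)ᵀ
      exact Units.continuous_coe_inv.matrix_transpose
    · show Continuous fun g : GL (Fin 3) F => ((g : GL (Fin 3) F) : Matrix (Fin 3) (Fin 3) F)ᵀ
      exact Units.continuous_val.matrix_transpose
  -- the involution
  let θf : GL (Fin 3) F → GL (Fin 3) F := fun g => Wu * t g * Wu
  have hθf_mul : ∀ g h, θf (g * h) = θf g * θf h := by
    intro g h
    show Wu * t (g * h) * Wu = Wu * t g * Wu * (Wu * t h * Wu)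
    rw [ht_mul]
    simp only [mul_assoc]
    rw [← mul_assoc Wu Wu (t h * Wu), hWu2, one_mul]
  have hθf_invol : ∀ g, θf (θf g) = g := by
    intro g
    show Wu * t (Wu * t g * Wu) * Wu = g
    rw [ht_mul, ht_mul, ht_W, ht_invol]
    simp only [mul_assoc]
    rw [← mul_assoc Wu Wu (g * (Wu * Wu)), hWu2, one_mul, mul_one]
  have hθf_cont : Continuous θf := (continuous_const.mul ht_cont).mul continuous_const
  refine ⟨{ toFun := θf, invFun := θf, left_inv := hθf_invol, right_inv := hθf_invol, map_mul' := hθf_mul,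
            continuous_toFun := hθf_cont, continuous_invFun := hθf_cont }, fun g i j => ?_, hθf_invol⟩
  show (((Wu * t g * Wu : GL (Fin 3) F)) : Matrix (Fin 3) (Fin 3) F) i j = _
  rw [Units.val_mul, Units.val_mul, ht_val]
  change (((!![0, 0, 1; 0, 1, 0; 1, 0, 0] : Matrix (Fin 3) (Fin 3) F) * ((g⁻¹ : GL (Fin 3) F) : Matrix (Fin 3) (Fin 3) F)ᵀ *
    (!![0, 0, 1; 0, 1, 0; 1, 0, 0] : Matrix (Fin 3) (Fin 3) F) : Matrix (Fin 3) (Fin 3) F) i j) = _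
  rw [antidiag_mul_mul_antidiag_apply, Matrix.transpose_apply]

end Theta

/-! ## §2b  Membership transfers under `θ` and under relabelling -/

section Membership

variable {F : Type*} [Field F] [ValuativeRel F] [TopologicalSpace F] [IsNonarchimedeanLocalField F]

omit [IsNonarchimedeanLocalField F] in
/-- `θ` preserves `K = GL₃(𝒪)`: the entries of `θ g` are entries of `g⁻¹`, those of `(θ g)⁻¹ = θ(g⁻¹)` are entries of `g`. [cite: BernsteinZelevinsky1977, §2.1] -/
theorem mem_glInt_iff_of_entry (θ : GL (Fin 3) F ≃ₜ* GL (Fin 3) F)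
    (hθ : ∀ (g : GL (Fin 3) F) (i j : Fin 3), ((θ g : GL (Fin 3) F) : Matrix (Fin 3) (Fin 3) F) i j =
      ((g⁻¹ : GL (Fin 3) F) : Matrix (Fin 3) (Fin 3) F) j.rev i.rev)
    (hθθ : ∀ g : GL (Fin 3) F, θ (θ g) = g) (g : GL (Fin 3) F) : g ∈ glInt 3 F ↔ θ g ∈ glInt 3 F := by
  have fwd : ∀ g : GL (Fin 3) F, g ∈ glInt 3 F → θ g ∈ glInt 3 F := by
    intro g hg
    obtain ⟨h1, h2⟩ := (mem_glInt_iff g).1 hg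
    refine (mem_glInt_iff (θ g)).2 ⟨fun i j => ?_, fun i j => ?_⟩
    · rw [hθ]; exact h2 _ _
    · rw [← map_inv θ g, hθ, inv_inv]; exact h1 _ _
  exact ⟨fwd g, fun h => by rw [← hθθ g]; exact fwd _ h⟩

omit [ValuativeRel F] [IsNonarchimedeanLocalField F] in
/-- `θ` maps the Levi `M₍₁,₂₎ = diag(GL₁ × GL₂)` (label `![false,true,true]`) onto `M₍₂,₁₎ = diag(GL₂ × GL₁)` (label `![false,false,true]`) and back
(block-diagonality of `g⁻¹`, transposed and index-reversed). [cite: BernsteinZelevinsky1977, §2.1] -/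
theorem mem_standardLeviGL_oneTwo_iff_of_entry (θ : GL (Fin 3) F ≃ₜ* GL (Fin 3) F)
    (hθ : ∀ (g : GL (Fin 3) F) (i j : Fin 3), ((θ g : GL (Fin 3) F) : Matrix (Fin 3) (Fin 3) F) i j =
      ((g⁻¹ : GL (Fin 3) F) : Matrix (Fin 3) (Fin 3) F) j.rev i.rev)
    (hθθ : ∀ g : GL (Fin 3) F, θ (θ g) = g) (g : GL (Fin 3) F) :
    g ∈ standardLeviGL F (![false, true, true] : Fin 3 → Bool) ↔ θ g ∈ standardLeviGL F (![false, false, true] : Fin 3 → Bool) := by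
  have fwd₁ : ∀ g : GL (Fin 3) F, g ∈ standardLeviGL F (![false, true, true] : Fin 3 → Bool) →
      θ g ∈ standardLeviGL F (![false, false, true] : Fin 3 → Bool) := by
    intro g hg
    refine (mem_standardLeviGL_iff _ _).2 fun i j hij => ?_
    rw [hθ]
    exact (mem_standardLeviGL_iff _ _).1 (inv_mem hg) _ _ (by revert hij; fin_cases i <;> fin_cases j <;> decide)
  have fwd₂ : ∀ g : GL (Fin 3) F, g ∈ standardLeviGL F (![false, false, true] : Fin 3 → Bool) →
      θ g ∈ standardLeviGL F (![false, true, true] : Fin 3 → Bool) := by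
    intro g hg
    refine (mem_standardLeviGL_iff _ _).2 fun i j hij => ?_
    rw [hθ]
    exact (mem_standardLeviGL_iff _ _).1 (inv_mem hg) _ _ (by revert hij; fin_cases i <;> fin_cases j <;> decide)
  exact ⟨fwd₁ g, fun h => by rw [← hθθ g]; exact fwd₂ _ h⟩

omit [ValuativeRel F] [IsNonarchimedeanLocalField F] in
/-- `θ` maps the unipotent radical `U₍₁,₂₎` onto `U₍₂,₁₎` and back (the unipotent pattern of `u⁻¹`, transposed and index-reversed). [cite: BernsteinZelevinsky1977, §2.1] -/
theorem mem_unipotentRadicalGL_oneTwo_iff_of_entry (θ : GL (Fin 3) F ≃ₜ* GL (Fin 3) F)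
    (hθ : ∀ (g : GL (Fin 3) F) (i j : Fin 3), ((θ g : GL (Fin 3) F) : Matrix (Fin 3) (Fin 3) F) i j =
      ((g⁻¹ : GL (Fin 3) F) : Matrix (Fin 3) (Fin 3) F) j.rev i.rev)
    (hθθ : ∀ g : GL (Fin 3) F, θ (θ g) = g) (g : GL (Fin 3) F) :
    g ∈ unipotentRadicalGL F (![false, true, true] : Fin 3 → Bool) ↔ θ g ∈ unipotentRadicalGL F (![false, false, true] : Fin 3 → Bool) := by
  classical
  have key : ∀ {α β : Type} [LinearOrder α] [LinearOrder β] (c₁ : Fin 3 → α) (c₂ : Fin 3 → β),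
      (∀ i j : Fin 3, c₂ j < c₂ i → c₁ i.rev < c₁ j.rev) → (∀ i j : Fin 3, c₂ i = c₂ j → c₁ j.rev = c₁ i.rev) →
      ∀ g : GL (Fin 3) F, g ∈ unipotentRadicalGL F c₁ → θ g ∈ unipotentRadicalGL F c₂ := by
    intro α β _ _ c₁ c₂ hlt heq g hg
    obtain ⟨h0, h1⟩ := (mem_unipotentRadicalGL_iff_entry c₁ (g⁻¹)).1 (inv_mem hg)
    refine (mem_unipotentRadicalGL_iff_entry c₂ (θ g)).2 ⟨fun i j hij => ?_, fun i j hij => ?_⟩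
    · rw [hθ]; exact h0 _ _ (hlt i j hij)
    · rw [hθ, h1 _ _ (heq i j hij)]
      by_cases hij' : i = j
      · subst hij'; simp
      · rw [if_neg (fun e => hij' (Fin.rev_injective e).symm), if_neg hij']
  have fwd₁ := key (![false, true, true] : Fin 3 → Bool) (![false, false, true] : Fin 3 → Bool) (by decide) (by decide)
  have fwd₂ := key (![false, false, true] : Fin 3 → Bool) (![false, true, true] : Fin 3 → Bool) (by decide) (by decide)
  exact ⟨fwd₁ g, fun h => by rw [← hθθ g]; exact fwd₂ _ h⟩

omit [ValuativeRel F] [TopologicalSpace F] [IsNonarchimedeanLocalField F] in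
/-- Relabelling `Fin 2 ↔ Bool`, Levi: `M_{(0,0,1)} = M_{(f,f,t)}` and `M_{(0,1,1)} = M_{(f,t,t)}` (same block partitions). [cite: BernsteinZelevinsky1977, §2.1] -/
theorem mem_standardLeviGL_fin2_iff_bool (g : GL (Fin 3) F) :
    (g ∈ standardLeviGL F (![0, 0, 1] : Fin 3 → Fin 2) ↔ g ∈ standardLeviGL F (![false, false, true] : Fin 3 → Bool)) ∧
    (g ∈ standardLeviGL F (![0, 1, 1] : Fin 3 → Fin 2) ↔ g ∈ standardLeviGL F (![false, true, true] : Fin 3 → Bool)) := by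
  simp only [mem_standardLeviGL_iff]
  refine ⟨⟨fun h i j hij => h i j ?_, fun h i j hij => h i j ?_⟩, ⟨fun h i j hij => h i j ?_, fun h i j hij => h i j ?_⟩⟩ <;>
    (revert hij; fin_cases i <;> fin_cases j <;> decide)

omit [ValuativeRel F] [TopologicalSpace F] [IsNonarchimedeanLocalField F] in
/-- Relabelling `Fin 2 ↔ Bool`, unipotent radicals: `U_{(0,0,1)} = U_{(f,f,t)}` and `U_{(0,1,1)} = U_{(f,t,t)}`. [cite: BernsteinZelevinsky1977, §2.1] -/
theorem mem_unipotentRadicalGL_fin2_iff_bool (g : GL (Fin 3) F) :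
    (g ∈ unipotentRadicalGL F (![0, 0, 1] : Fin 3 → Fin 2) ↔ g ∈ unipotentRadicalGL F (![false, false, true] : Fin 3 → Bool)) ∧
    (g ∈ unipotentRadicalGL F (![0, 1, 1] : Fin 3 → Fin 2) ↔ g ∈ unipotentRadicalGL F (![false, true, true] : Fin 3 → Bool)) := by
  classical
  have key : ∀ {α β : Type} [LinearOrder α] [LinearOrder β] (c₁ : Fin 3 → α) (c₂ : Fin 3 → β),
      (∀ i j : Fin 3, c₂ j < c₂ i → c₁ j < c₁ i) → (∀ i j : Fin 3, c₂ i = c₂ j → c₁ i = c₁ j) →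
      g ∈ unipotentRadicalGL F c₁ → g ∈ unipotentRadicalGL F c₂ := by
    intro α β _ _ c₁ c₂ hlt heq hg
    obtain ⟨h0, h1⟩ := (mem_unipotentRadicalGL_iff_entry c₁ g).1 hg
    exact (mem_unipotentRadicalGL_iff_entry c₂ g).2 ⟨fun i j hij => h0 i j (hlt i j hij), fun i j hij => h1 i j (heq i j hij)⟩
  exact ⟨⟨key _ _ (by decide) (by decide), key _ _ (by decide) (by decide)⟩, ⟨key _ _ (by decide) (by decide), key _ _ (by decide) (by decide)⟩⟩

end Membership

end Summit.HodgeConjecture.HodgeConjecture.Cruxes.H413.K2E3GL3KMUAbsContTransport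

end
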